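import Mathlib
import Summits.Ventures.FusionMHD.Models.CerfonFreidbergIterLikeQHalfResDefs
import HarnessLib

/-!
# Ventures/FusionMHD — Models/CerfonFreidbergIterLikeQHalfResPanels8.lean: KERNEL CHECK of the resistive-register certificates of panel(s) 12, 13 (of 32)
# at `ψ_N = 1/2` of THE Cerfon–Freidberg ITER-like instance

HONEST FRAMING (LADDER-GRIDFUSION three columns; CF rung; rider «D_R at ψ_N = 1/2»).  One `decide +kernel` (≈ 60–90 s): for each listed panel the obligation
`CFIterLike.QHalfRes.ResCert.ok` (`Models/CerfonFreidbergIterLikeQHalfResDefs.lean`) — the Taylor-model run of `progR = progM ++ block3R` over ★ #117's parameter box is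
ACCEPTED and the kernel's two panel-integral enclosures (`g_AG`, `g_W` along the approximant) lie inside the claimed integers (compiled `#eval` of the same functions, slack
one unit of `2⁻⁶⁰`; float truth inside every panel, `genqm/truthR.json`).  MODELLED: analytic Cerfon–Freidberg family; nothing about a device or stability.
No `native_decide`.  Typer/prover: gridfusion-model-7 (g7), 2026-08-28.  Citations: Zheng 2015 §3.2 (3.42) [Zheng2015];
Mahboubi–Melquiond–Sibut-Pinote 2016 §3.2 Lemma 3 [MahboubiMelquiondSibutpinote2016].
-/

namespace Summit.Ventures.FusionMHD.Models.CFIterLike.QHalfRes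

/-- Resistive-register certificate data of panel(s) 12, 13. [instance data] -/
def resCert8 : List ResCert := [
  { j := 12, cand1 := [323790092523263754240, 2427795703041017511936, 14388756993187726229504, 66854846587439054585856, 248281889911147564367872, 652841336599574824878080, 439383275470522656227328, -7985640759666851669082112, -63268339059694125474381824, -331701689125958440202534912, -3746456203233794551166533632, 22483871540001995887470444544, 3630152751518631485029700599808],
    cand2 := [284876016114520162304, 1844118885755178975232, 11905376349020135358464, 63351141310877596123136, 289473383837652582662144, 1107917747557939097370624, 3230748364682439010811904, 3894253157211894605414400, -33852814053164823487709184, -382023216507688694518382592, -4375058189316018327143841792, 17196330801433503167869353984, 2794908155252119764056334663680],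
    deg := 10, e1 := 43, e2 := 43, glo := 5175983996829775, ghi := 5175984457354612, wlo := 266857928152319977, whi := 266857948694572500 },
  { j := 13, cand1 := [416006821546312663040, 3556386337384796520448, 22309644429206231187456, 104131258904980223950848, 342490870700842063757312, 414558317140967193313280, -4126939901648684997148672, -39961938660027666538692608, -215675047677434505950396416, -773001316873783747578691584, 7688609385997865968065314816, 26256805850286115433740238848, -12123996221027406351422705369088],
    cand2 := [356376558770556305408, 2815014333205744975872, 19926047678393435029504, 112360706973863046545408, 509824316143198588108800, 1667682548366499672752128, 1547739299112238863876096, -30766749696663809811283968, -323143898084933241694846976, -2103514530003118149993496576, -5878863535418452500281294848, -39776819439060121628023193600, -6610533798119438982571632885760],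
    deg := 10, e1 := 44, e2 := 43, glo := 5231101797993754, ghi := 5231102446221569, wlo := 295961785100019271, whi := 295961817747585040 }]

/-- **KERNEL CHECK** of the two resistive registers on panel(s) 12, 13. -/
theorem resCert8_ok : CFIterLike.QHalfRes.resCert8.all ResCert.ok = true := by
  decide +kernel

end Summit.Ventures.FusionMHD.Models.CFIterLike.QHalfRes
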